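import Summits.QuantumFields.BalabanUV.T4Continuum.Support.ShellMeasureAverageProp3Remainder
import Literature.MathematicalPhysics.QuantumFieldTheory.Balaban1983to89.B7Prop3GeneralTild

/-!
# [B7] Proposition 3 at a general background: the Prop.-4 binders (H-rem) and (H-sub) discharged

Row S55 (analytic∕remainder half) of the pub-balaban NE7c crew table, the junction with row S56:
`B7Prop4GeneralLevels.prop4_general_of_prop3` (the k-uniform induction (128)–(133) of [Balaban1985Averaging] Prop. 4 at a
general regular background) takes Proposition 3 at a general background as THREE displayed hypotheses `h3rem`
((123): `‖Q − LQ‖ ≤ C₁L²a²`), `h3lin` ((126): `‖LQ‖ ≤ L(1 + cL²β)a`), `h3sub` (additivity of `LQ`), each quantified over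
backgrounds `V₀` in an averaging-closed subgroup `G ≤ {|u| ≤ 1, |u⁻¹| ≤ 1}` with PLAQUETTE deviation `pdev V₀ < β ≤ βmax`
and fields `sup_b‖A_b‖ ≤ a ≤ c₃`.

THIS FILE DISCHARGES `h3rem` AND `h3sub` IN EXACTLY THOSE SHAPES (the constants instantiated):
* `loopReg_of_pdev` — plaquette deviation `pdev V₀ < β` with `1024(d+1)(d+4)L²β ≤ 1` gives `α`-regular block contours at
  every `L`-bond, `α = 16(d+1)(d+4)L²β ≤ 1/64` ([B7] p. 25 via b07's `B7Prop2Explicit.norm_Wcx_sub_one_le` = Prop. 1 in the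
  axial gauge).
* **`h3rem_discharge`** — `h3rem` with `βmax := 1/(1024(d+1)(d+4)L²)`, `c₃ := c₃(d,L)/2` (`B7Prop3Flat.c3`), `C₁ := 131072(d+1)²`:
  the one-variable Cauchy estimate `ShellMeasureAverageProp3Remainder.prop3_general_remainder_explicit` on
  `B7Prop3GeneralLinear.Qcov ∕ linQcov` (definitionally `mlog ∘ dbavgCov ∘ expCfg` and its ray derivative), the degenerate
  field `a = 0` handled separately (`Qcov_zero`, `deriv` of a constant).
* **`h3sub_discharge`** — `h3sub` with the same `βmax`: the linear half's `B7Prop3GeneralTild.linQcov_add ∕ linQcov_smul`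
  (leaf-05-g6) under the loop-domain condition supplied by `loopReg_of_pdev`.
`h3lin` ((126) with leading coefficient exactly `L`) is the linear half's (124)-based bound, not made here.

HONEST: junction bookkeeping between two reproduction files; «NE7c ⇐ the named binders»; NE7c is NOT printed and NOT proved
here; nothing about the continuum limit is claimed.

HONEST FRAMING (cell, verbatim): rung (B)+1 on a FINITE `T⁴` — NOT infinite volume, NOT mass gap, NOT Clay; NE7c NOT
PRINTED, NOT PROVED; spine PROVED 0/9.  HONEST DEPENDENCY: continuum YM on T⁴ ⇐ BetaPertH ∧ nine spine estimates (0/9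
proved); BetaPertH ⇐ (D1) ∧ (D4) ∧ CAP+tail; G-an2-4 gates asym, D1 and NE2/3/4.

v1.1 (DOCFIX, module docstring only; declarations byte-identical): the cell's HONEST sentences added (XREAD C-ne7cleaf09-39).
-/

noncomputable section

open scoped BigOperators
open NormedSpace

namespace Summit.QuantumFields.BalabanUV.T4Continuum.ShellMeasureAverageProp3Discharge

open Literature.MathematicalPhysics.QuantumFieldTheory.Balaban1983to89
open B7Prop1Explicit B7Prop2Explicit B7Prop3Flat B7Eq92Concrete MatrixLog B7Prop3GeneralAnalytic B7Prop3GeneralLinear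
open B7Prop3GeneralTild (linQcov_add linQcov_smul)
open Summit.QuantumFields.BalabanUV.T4Continuum.ShellMeasureAverageProp3Remainder (prop3_general_remainder_explicit)

variable {d : ℕ}
variable {𝔸 : Type*} [NormedRing 𝔸] [NormedAlgebra ℂ 𝔸] [CompleteSpace 𝔸] [NormOneClass 𝔸]

/-- **Plaquette deviation ⟹ regular block contours at every `L`-bond** ([B7] p. 25 «|V₀(Γ_{c,x}) − 1| < |Γ_{c,x}|dLα₀ <
(2d+1)LdLα₀ = O(1)L²α₀», b07's `B7Prop2Explicit.norm_Wcx_sub_one_le`): `pdev V₀ < β`, `1024(d+1)(d+4)L²β ≤ 1` give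
`‖V₀(Γ_{c,x})V₀(c)⁻¹ − 1‖ ≤ 16(d+1)(d+4)L²β ≤ 1/64`. [folklore] -/
theorem loopReg_of_pdev {L : ℕ} (hL : 1 ≤ L) {V₀ : B7Prop1Explicit.Site d → Fin d → 𝔸ˣ}
    (hV₀ : ∀ x κ, V₀ x κ ∈ U1 𝔸) {β : ℝ} (hβ0 : 0 ≤ β) (hβ : pdev V₀ < β)
    (hβmax : β ≤ 1 / (1024 * ((d : ℝ) + 1) * ((d : ℝ) + 4) * (L : ℝ) ^ 2)) (q : B7Prop1Explicit.Site d) (κ : Fin d) :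
    (∀ r : Fin d → Fin L,
      ‖((Wcx L V₀ q κ (boxVec L r) : 𝔸ˣ) : 𝔸) - 1‖ ≤ 16 * ((d : ℝ) + 1) * ((d : ℝ) + 4) * (L : ℝ) ^ 2 * β) ∧
    16 * ((d : ℝ) + 1) * ((d : ℝ) + 4) * (L : ℝ) ^ 2 * β ≤ 1 / 64 := by
  have hL0 : (0 : ℝ) < L := by exact_mod_cast hL
  have hX : (0 : ℝ) < 1024 * ((d : ℝ) + 1) * ((d : ℝ) + 4) * (L : ℝ) ^ 2 := by positivity
  have hXβ : 1024 * ((d : ℝ) + 1) * ((d : ℝ) + 4) * (L : ℝ) ^ 2 * β ≤ 1 := by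
    have := mul_le_mul_of_nonneg_left hβmax hX.le
    rwa [one_div, mul_inv_cancel₀ hX.ne'] at this
  refine ⟨fun r => ?_, by nlinarith⟩
  have h := norm_Wcx_sub_one_le L hL V₀ hV₀ hβ0 (by nlinarith)
    (fun x κ₁ κ₂ _ => (le_pdev hV₀ x κ₁ κ₂).trans hβ.le) q κ r
  refine h.trans (le_of_eq ?_)
  ring

/-- **(H-rem) DISCHARGED** — `B7Prop4GeneralLevels.prop4_general_of_prop3`'s binder `h3rem` with
`βmax := 1/(1024(d+1)(d+4)L²)`, `c₃ := c₃(d,L)/2`, `C₁ := 131072(d+1)²`: for every background `V₀` in a subgroup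
`G ≤ {|u| ≤ 1, |u⁻¹| ≤ 1}` with plaquette deviation `pdev V₀ < β ≤ βmax` and every field with `sup_b‖A_b‖ ≤ a ≤ c₃(d,L)/2`,
`‖Q(V₀, A, c) − L(Q(V₀)A)_c‖ ≤ 131072(d+1)²·L²·a²` at every `L`-bond `c` — [Balaban1985Averaging] Prop. 3 (123)
«|C(V₀, A, c)| ≦ C₁L²|A|², C₁ depends on d» by the Cauchy estimate along the ray
(`ShellMeasureAverageProp3Remainder.prop3_general_remainder_explicit`). [cite: Balaban1985Averaging, Proposition 3 (123) p.36] -/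
theorem h3rem_discharge {L : ℕ} (hL : 1 ≤ L) {G : Subgroup 𝔸ˣ} (hG : G ≤ U1 𝔸) :
    ∀ (V₀ : B7Prop1Explicit.Site d → Fin d → 𝔸ˣ) (β : ℝ), (∀ x κ, V₀ x κ ∈ G) → 0 ≤ β → pdev V₀ < β →
      β ≤ 1 / (1024 * ((d : ℝ) + 1) * ((d : ℝ) + 4) * (L : ℝ) ^ 2) →
      ∀ (A : B7Prop1Explicit.Site d → Fin d → 𝔸) (a : ℝ), 0 ≤ a → a ≤ c3 d L / 2 → (∀ x κ, ‖A x κ‖ ≤ a) →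
      ∀ q κ, ‖Qcov L V₀ A q κ - linQcov L V₀ A q κ‖ ≤ 131072 * ((d : ℝ) + 1) ^ 2 * (L : ℝ) ^ 2 * a ^ 2 := by
  intro V₀ β hVG hβ0 hβ hβmax A a ha0 hac hA q κ
  have hV₀ : ∀ x κ, V₀ x κ ∈ U1 𝔸 := fun x κ => hG (hVG x κ)
  obtain ⟨hreg, hα1⟩ := loopReg_of_pdev hL hV₀ hβ0 hβ hβmax q κ
  rcases ha0.eq_or_lt with h0 | hpos
  · -- the degenerate field `A = 0`
    have hA0 : A = 0 := by
      funext x κ'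
      have := hA x κ'
      rw [← h0] at this
      exact norm_le_zero_iff.1 this
    subst hA0
    have hlin : linQcov L V₀ (0 : B7Prop1Explicit.Site d → Fin d → 𝔸) q κ = 0 := by
      simp only [linQcov, smul_zero, Qcov_zero, deriv_const]
    rw [Qcov_zero, hlin, sub_zero, norm_zero]
    positivity
  · have hac' : a < c3 d L := by have := c3_pos d hL; linarith
    exact prop3_general_remainder_explicit hL hV₀ A hpos hA hac' q κ hα1 hreg

/-- **(H-sub) DISCHARGED** — `prop4_general_of_prop3`'s binder `h3sub` with the same `βmax`: «L(Q(V₀)A)_c» is additive,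
`LQ(A − A′) = LQ A − LQ A′`, for every background with `pdev V₀ < β ≤ βmax` — the linear half's `linQcov_add`∕`linQcov_smul`
(`B7Prop3GeneralTild`, from the closed form (120)/(122)) under the loop-domain condition that `loopReg_of_pdev` supplies.
[cite: Balaban1985Averaging, Proposition 3 (122) p.36] -/
theorem h3sub_discharge {L : ℕ} (hL : 1 ≤ L) {G : Subgroup 𝔸ˣ} (hG : G ≤ U1 𝔸) :
    ∀ (V₀ : B7Prop1Explicit.Site d → Fin d → 𝔸ˣ) (β : ℝ), (∀ x κ, V₀ x κ ∈ G) → 0 ≤ β → pdev V₀ < β →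
      β ≤ 1 / (1024 * ((d : ℝ) + 1) * ((d : ℝ) + 4) * (L : ℝ) ^ 2) →
      ∀ (A A' : B7Prop1Explicit.Site d → Fin d → 𝔸) (q : B7Prop1Explicit.Site d) (κ : Fin d),
      linQcov L V₀ (A - A') q κ = linQcov L V₀ A q κ - linQcov L V₀ A' q κ := by
  intro V₀ β hVG hβ0 hβ hβmax A A' q κ
  have hV₀ : ∀ x κ, V₀ x κ ∈ U1 𝔸 := fun x κ => hG (hVG x κ)
  obtain ⟨hreg, hα1⟩ := loopReg_of_pdev hL hV₀ hβ0 hβ hβmax q κ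
  have hW : ∀ r : Fin d → Fin L, ‖((Wcx L V₀ q κ (boxVec L r) : 𝔸ˣ) : 𝔸) - 1‖ < 1 :=
    fun r => ((hreg r).trans hα1).trans_lt (by norm_num)
  rw [sub_eq_add_neg, linQcov_add L V₀ A (-A') q κ hW, ← neg_one_smul ℂ A', linQcov_smul L V₀ (-1) A' q κ hW,
    neg_one_smul, ← sub_eq_add_neg]

/-- The same additivity from the analytic side (two-parameter analyticity at the origin,
`ShellMeasureAverageProp3Remainder.ray_deriv_add ∕ ray_deriv_smul`) — a cross-check that the derivative-defined «LQ» of the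
linear half and the ray derivative of the analytic half are the same object (`rfl`). [folklore] -/
theorem h3sub_discharge' {L : ℕ} (hL : 1 ≤ L) {V₀ : B7Prop1Explicit.Site d → Fin d → 𝔸ˣ}
    (hV₀ : ∀ x κ, V₀ x κ ∈ U1 𝔸) {α : ℝ} (q : B7Prop1Explicit.Site d) (κ : Fin d) (hα1 : α ≤ 1 / 64)
    (hreg : ∀ r : Fin d → Fin L, ‖((Wcx L V₀ q κ (boxVec L r) : 𝔸ˣ) : 𝔸) - 1‖ ≤ α)
    (A A' : B7Prop1Explicit.Site d → Fin d → 𝔸) :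
    linQcov L V₀ (A - A') q κ = linQcov L V₀ A q κ - linQcov L V₀ A' q κ := by
  have hadd := ShellMeasureAverageProp3Remainder.ray_deriv_add hL hV₀ A (-A') q κ hα1 hreg
  have hsmul := ShellMeasureAverageProp3Remainder.ray_deriv_smul hL hV₀ A' (-1) q κ hα1 hreg
  change linQcov L V₀ (A + -A') q κ = linQcov L V₀ A q κ + linQcov L V₀ (-A') q κ at hadd
  change linQcov L V₀ ((-1 : ℂ) • A') q κ = (-1 : ℂ) • linQcov L V₀ A' q κ at hsmul
  rw [neg_one_smul, neg_one_smul] at hsmul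
  rw [sub_eq_add_neg, hadd, hsmul, ← sub_eq_add_neg]

end Summit.QuantumFields.BalabanUV.T4Continuum.ShellMeasureAverageProp3Discharge

end
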